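import Literature.NumberTheory.Weil1965.AdelicFibreMeasures
import Literature.NumberTheory.Weil1965.SplitPlaceFibreMeasureInvariance
import HarnessLib

/-!
# Fibre measures of ANY positive functional on `𝒮_ℝ(𝔸_F^ι)` at a split place: Lemme 22 inputs and `c(φ) · μ_{b',v}`

Topic `NumberTheory/Weil1965`; namespace `Literature.NumberTheory.Weil1965`.  KERNEL mathematics only (theorems; no definition,
no named fact, no `axiom`, no `sorry`).  GENERIC form of ★ `AdelicSiegelFibreMeasureSplitPlace` ∕ `…Weighted` (which treat Weil's
`E_X`): here `S` is ANY positive linear functional on the real Schwartz–Bruhat functions of `X = 𝔸_F^ι` and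
`μ_b = fibreMeasure F ι S hS h b = ν_S|_{h⁻¹(b)}` its fibre measure (★ `AdelicFibreMeasures` §Generic) — the common currency of the
Eisenstein side (`S = E_X`, ★ `adelicSiegelFibreMeasure`) AND of the theta side (`S = ` the orbit functional of the theta integral) of
the Siegel–Weil identity [Weil1965, Chap. IV n° 41 (35), n° 46; Chap. V n° 51].

Along a SPLIT-PLACE CHART `e : X ≃ (K^κ × K^κ) × Y` at a finite place `v` (letter (BRIDGE-v) of the SW2 I-CLOSE sheet: homeomorphisms
`T g` of `X`, `g ∈ GL_κ(K)`, with `h ∘ T g = h`, `𝒮 ∘ T g ⊆ 𝒮`, `S` INVARIANT (`hST`), acting through `e` by `(x, y) ↦ (g x, g⁻ᵀ y)`,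
and the fibre `h = b` inside the max-rank split locus `S_{b'} × Y`) the transported fibre measure `e_* μ_b`

* is invariant under `((g, g⁻ᵀ) × id)` (`map_splitAct_map_fibreMeasure_eq`; ★ `map_fibreMeasure_eq`), gives no mass to `S_{b'}ᶜ × Y`
  (`map_fibreMeasure_compl_splitLocus_prod_univ`; ★ `fibreMeasure_compl`) and is finite on compacta (★ `fibreMeasure_le`,
  ★ `regular_schwartzBruhatMeasure`) — `map_fibreMeasure_identityClose_hypotheses` states the three in the shapes of the I-CLOSE
  consumer (★ `Theorems/H413E2SWIdentityCloseSplit :: marginal_eq_smul_marginal_of_dilate_bound`, binders `hfinᵢ hinvᵢ hcarᵢ`);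
* hence, by Lemme 22 (★ `SplitPlace.exists_lintegral_fst_mul_indicator_snd_eq_mul_fibreMeasure`) applied to
  `(e_* μ_b).withDensity (φ ∘ snd)`, for every Borel weight `φ ≥ 0` on `Y` finite against `e_* μ_b` over compacta:
  `∫⁻ f(z) φ(y) d(e_* μ_b) = c(φ) · ∫⁻ f dμ_{b',v}` (`exists_lintegral_mul_weight_map_fibreMeasure_eq_mul_fibreMeasure`; finiteness
  discharged for bounded `φ` vanishing off a relatively compact set, `…_of_bdd`, and for `φ` dominated on `e⁻¹(C × Y)` by a
  nonnegative Schwartz–Bruhat function — temperedness of `ν_S`, ★ `integral_schwartzBruhatMeasure_le_of_nonneg` — `…_of_schwartzBruhat`;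
  Bochner form; rectangles `(e_* μ_b)(A × B) = c_B · μ_{b',v}(A)`).

Cell `hodgecm-mathlib`, FLOOR 0, crux H413 (stmt-HodgeConjecture-24833), E-2 ∕ SW2 I-CLOSE sheet c78afe1b §1 ((E-FAC) and its Θ-twin,
ruling «WEIGHTS»).  HC_CM is proved only modulo the 7 printed citations until rung 0 closes; this file is unconditional.

## References
* [Weil1965] A. Weil, *Sur la formule de Siegel dans la théorie des groupes classiques*, Acta Math. 113 (1965): Chap. I n° 2
  Lemme 3 p. 7; Chap. IV n° 41 (35) p. 59, n° 46 p. 66; Chap. V n° 49 Lemme 22 p. 70, n° 51 p. 73.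
-/

set_option autoImplicit false

noncomputable section

open MeasureTheory Filter Topology Set NumberField IsDedekindDomain
open scoped NNReal ENNReal Matrix Classical
open Literature.NumberTheory.Automorphic
open Literature.NumberTheory.Weil1964
open Literature.NumberTheory.GaloisRepresentations.IsNonarchimedeanLocalField

namespace Literature.NumberTheory.Weil1965

section HelpersG
variable {K : Type*} [Field K] [ValuativeRel K] [TopologicalSpace K] [IsNonarchimedeanLocalField K]

/-- instance helper: `K` is second countable. [folklore] -/
private theorem secondCountable_K'' : SecondCountableTopology K := secondCountableTopology_localField K

/-- instance helper: `K` is Hausdorff. [folklore] -/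
private theorem t2_K'' : T2Space K :=
  (Literature.NumberTheory.GaloisRepresentations.IsNonarchimedeanLocalField.isLocalField K).toT2Space

end HelpersG

variable (F : Type) [Field F] [NumberField F] (ι : Type) [Fintype ι]
  [MeasurableSpace (AdeleRing (𝓞 F) F)] [BorelSpace (AdeleRing (𝓞 F) F)]
  (S : piSchwartzBruhatReal F ι →ₗ[ℝ] ℝ)
  (hS : ∀ Ψ : piSchwartzBruhatReal F ι, 0 ≤ (Ψ : (ι → AdeleRing (𝓞 F) F) → ℝ) → 0 ≤ S Ψ)
  (h : (ι → AdeleRing (𝓞 F) F) → AdeleRing (𝓞 F) F) (hh : Continuous h)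
  {K : Type*} [Field K] [ValuativeRel K] [TopologicalSpace K] [IsNonarchimedeanLocalField K]
  [MeasurableSpace K] [BorelSpace K] [MeasurableSingletonClass K] (μK : Measure K) [μK.IsAddHaarMeasure]
  {κ : Type*} [Fintype κ] [Nonempty κ] [DecidableEq κ] (hκ : 2 ≤ Fintype.card κ)
  {Y : Type*} [TopologicalSpace Y] [T2Space Y] [MeasurableSpace Y] [BorelSpace Y] [SecondCountableTopology Y]
  (e : (ι → AdeleRing (𝓞 F) F) ≃ₜ ((κ → K) × (κ → K)) × Y)
  (b : F) (b' : K)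
  (hfib : ∀ x, h x = algebraMap F (AdeleRing (𝓞 F) F) b →
    (e x).1.1 ⬝ᵥ (e x).1.2 = b' ∧ (e x).1.1 ≠ 0 ∧ (e x).1.2 ≠ 0)
  (T : GL κ K → ((ι → AdeleRing (𝓞 F) F) ≃ₜ (ι → AdeleRing (𝓞 F) F)))
  (hTh : ∀ g x, h (T g x) = h x)
  (hTS : ∀ g, ∀ Φ ∈ piSchwartzBruhat F ι, Φ ∘ T g ∈ piSchwartzBruhat F ι)
  (hST : ∀ g (Ψ : piSchwartzBruhatReal F ι)
    (hΨT : (Ψ : (ι → AdeleRing (𝓞 F) F) → ℝ) ∘ T g ∈ piSchwartzBruhatReal F ι),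
    S ⟨(Ψ : (ι → AdeleRing (𝓞 F) F) → ℝ) ∘ T g, hΨT⟩ = S Ψ)
  (hTe : ∀ g x, e (T g x) =
    ((((g : Matrix κ κ K) *ᵥ (e x).1.1, ((g⁻¹ : GL κ K) : Matrix κ κ K)ᵀ *ᵥ (e x).1.2) : (κ → K) × (κ → K)), (e x).2))

/-! ## §1 Invariance, carrier, finiteness of `e_* μ_b` -/

omit [MeasurableSingletonClass K] [Nonempty κ] [T2Space Y] in
include hTh hTS hST hTe in
/-- `e_* μ_b` is invariant under `((x, y), w) ↦ ((g x, g⁻ᵀ y), w)`, `g ∈ GL_κ(K)` — the push-forward form of ★ `map_fibreMeasure_eq`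
read through the chart `e`. [cite: Weil1965, Chap. IV n° 46, p. 66] -/
theorem map_splitAct_map_fibreMeasure_eq (g : GL κ K) :
    (((fibreMeasure F ι S hS h b).map e).map fun z : ((κ → K) × (κ → K)) × Y =>
        (((((g : Matrix κ κ K) *ᵥ z.1.1, ((g⁻¹ : GL κ K) : Matrix κ κ K)ᵀ *ᵥ z.1.2) : (κ → K) × (κ → K))), z.2)) =
      (fibreMeasure F ι S hS h b).map e := by
  haveI : SecondCountableTopology K := secondCountable_K''
  haveI : T2Space K := t2_K''
  haveI := secondCountableTopology_adeleRing (K := F)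
  haveI : BorelSpace (ι → AdeleRing (𝓞 F) F) := Pi.borelSpace
  haveI : BorelSpace (κ → K) := Pi.borelSpace
  haveI : BorelSpace ((κ → K) × (κ → K)) := Prod.borelSpace
  haveI : BorelSpace (((κ → K) × (κ → K)) × Y) := Prod.borelSpace
  set GG : ((κ → K) × (κ → K)) × Y → ((κ → K) × (κ → K)) × Y := fun z =>
    (((((g : Matrix κ κ K) *ᵥ z.1.1, ((g⁻¹ : GL κ K) : Matrix κ κ K)ᵀ *ᵥ z.1.2) : (κ → K) × (κ → K))), z.2) with hGG
  have hGGm : Measurable GG :=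
    (((continuous_const.matrix_mulVec (continuous_fst.comp continuous_fst)).prodMk
      (continuous_const.matrix_mulVec (continuous_snd.comp continuous_fst))).prodMk continuous_snd).measurable
  have hem : Measurable e := e.continuous.measurable
  have hcomp : GG ∘ e = e ∘ T g := funext fun x => (hTe g x).symm
  rw [Measure.map_map hGGm hem, hcomp, ← Measure.map_map hem (T g).continuous.measurable,
    map_fibreMeasure_eq F ι S hS h (T g) (hTh g) (hTS g) (hST g) b]

omit [MeasurableSingletonClass K] [Nonempty κ] [DecidableEq κ] [T2Space Y] in
include hfib hh in
/-- `e_* μ_b` gives no mass to `S_{b'}ᶜ × Y` (★ `fibreMeasure_compl` + `hfib`). [cite: Weil1965, Chap. IV n° 41 (35), p. 59] -/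
theorem map_fibreMeasure_compl_splitLocus_prod_univ :
    ((fibreMeasure F ι S hS h b).map e)
        ({z : (κ → K) × (κ → K) | z.1 ⬝ᵥ z.2 = b' ∧ z.1 ≠ 0 ∧ z.2 ≠ 0}ᶜ ×ˢ (univ : Set Y)) = 0 := by
  haveI : SecondCountableTopology K := secondCountable_K''
  haveI : T2Space K := t2_K''
  haveI := secondCountableTopology_adeleRing (K := F)
  haveI : BorelSpace (ι → AdeleRing (𝓞 F) F) := Pi.borelSpace
  haveI : BorelSpace (κ → K) := Pi.borelSpace
  haveI : BorelSpace ((κ → K) × (κ → K)) := Prod.borelSpace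
  haveI : BorelSpace (((κ → K) × (κ → K)) × Y) := Prod.borelSpace
  have hem : Measurable e := e.continuous.measurable
  have hsub : e ⁻¹' ({z : (κ → K) × (κ → K) | z.1 ⬝ᵥ z.2 = b' ∧ z.1 ≠ 0 ∧ z.2 ≠ 0}ᶜ ×ˢ (univ : Set Y)) ⊆
      (h ⁻¹' {algebraMap F (AdeleRing (𝓞 F) F) b})ᶜ := by
    intro x hx hxb
    simp only [mem_preimage, mem_prod, mem_compl_iff, mem_setOf_eq] at hx
    exact hx.1 (hfib x hxb)
  have hSm : MeasurableSet ({z : (κ → K) × (κ → K) | z.1 ⬝ᵥ z.2 = b' ∧ z.1 ≠ 0 ∧ z.2 ≠ 0}ᶜ ×ˢ (univ : Set Y)) := by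
    refine MeasurableSet.prod (MeasurableSet.compl ?_) MeasurableSet.univ
    have h1 : MeasurableSet {z : (κ → K) × (κ → K) | z.1 ⬝ᵥ z.2 = b'} :=
      (isClosed_eq (continuous_fst.dotProduct continuous_snd) continuous_const).measurableSet
    have h2 : MeasurableSet {z : (κ → K) × (κ → K) | z.1 ≠ 0} :=
      (isClosed_eq continuous_fst continuous_const).measurableSet.compl
    have h3 : MeasurableSet {z : (κ → K) × (κ → K) | z.2 ≠ 0} :=
      (isClosed_eq continuous_snd continuous_const).measurableSet.compl
    simpa only [setOf_and] using h1.inter (h2.inter h3)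
  rw [Measure.map_apply hem hSm]
  exact measure_mono_null hsub (fibreMeasure_compl F ι S hS h hh b)

omit [MeasurableSingletonClass K] [Nonempty κ] [DecidableEq κ] in
/-- `e_* μ_b` is finite on compact rectangles `L × B` (`μ_b ≤ ν_S`, a Radon measure; `e⁻¹(L × B)` compact).
[cite: Weil1965, Chap. I n° 2 Lemme 3, p. 7] -/
theorem map_fibreMeasure_prod_lt_top {L : Set ((κ → K) × (κ → K))} {B : Set Y} (hL : IsCompact L) (hB : IsCompact B) :
    ((fibreMeasure F ι S hS h b).map e) (L ×ˢ B) < ⊤ := by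
  haveI : SecondCountableTopology K := secondCountable_K''
  haveI : T2Space K := t2_K''
  haveI := secondCountableTopology_adeleRing (K := F)
  haveI : BorelSpace (ι → AdeleRing (𝓞 F) F) := Pi.borelSpace
  haveI : BorelSpace (κ → K) := Pi.borelSpace
  haveI : BorelSpace ((κ → K) × (κ → K)) := Prod.borelSpace
  haveI : BorelSpace (((κ → K) × (κ → K)) × Y) := Prod.borelSpace
  haveI : (schwartzBruhatMeasure F ι S hS).Regular := regular_schwartzBruhatMeasure F ι S hS
  calc ((fibreMeasure F ι S hS h b).map e) (L ×ˢ B)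
      = fibreMeasure F ι S hS h b (e ⁻¹' (L ×ˢ B)) :=
        Measure.map_apply e.continuous.measurable (hL.measurableSet.prod hB.measurableSet)
    _ ≤ schwartzBruhatMeasure F ι S hS (e ⁻¹' (L ×ˢ B)) := fibreMeasure_le F ι S hS h b _
    _ < ⊤ := (e.isCompact_preimage.2 (hL.prod hB)).measure_lt_top

omit [MeasurableSingletonClass K] [Nonempty κ] in
include hfib hh hTh hTS hST hTe in
/-- **the three inputs of the I-CLOSE comparison for `e_* μ_b`, any positive functional `S`** (consumer's binder shapes): finite on
compact rectangles, invariant on Borel rectangles under `(x, y) ↦ (g x, g⁻ᵀ y)`, carried by `S_{b'} × Y`.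
[cite: Weil1965, Chap. IV n° 46, p. 66; n° 41 (35), p. 59] -/
theorem map_fibreMeasure_identityClose_hypotheses :
    (∀ (L : Set ((κ → K) × (κ → K))) (B : Set Y), IsCompact L → IsCompact B →
      ((fibreMeasure F ι S hS h b).map e) (L ×ˢ B) < ⊤) ∧
    (∀ (g : GL κ K) (A : Set ((κ → K) × (κ → K))) (B : Set Y), MeasurableSet A → MeasurableSet B →
      ((fibreMeasure F ι S hS h b).map e)
        (((fun z => (((g : Matrix κ κ K) *ᵥ z.1, ((g⁻¹ : GL κ K) : Matrix κ κ K)ᵀ *ᵥ z.2) : (κ → K) × (κ → K))) ⁻¹' A) ×ˢ B) =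
      ((fibreMeasure F ι S hS h b).map e) (A ×ˢ B)) ∧
    ((fibreMeasure F ι S hS h b).map e)
        ({z : (κ → K) × (κ → K) | z.1 ⬝ᵥ z.2 = b' ∧ z.1 ≠ 0 ∧ z.2 ≠ 0}ᶜ ×ˢ (univ : Set Y)) = 0 := by
  haveI : SecondCountableTopology K := secondCountable_K''
  haveI : T2Space K := t2_K''
  haveI := secondCountableTopology_adeleRing (K := F)
  haveI : BorelSpace (ι → AdeleRing (𝓞 F) F) := Pi.borelSpace
  haveI : BorelSpace (κ → K) := Pi.borelSpace
  haveI : BorelSpace ((κ → K) × (κ → K)) := Prod.borelSpace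
  haveI : BorelSpace (((κ → K) × (κ → K)) × Y) := Prod.borelSpace
  refine ⟨fun L B hL hBc => map_fibreMeasure_prod_lt_top F ι S hS h e b hL hBc, fun g A B hA hBm => ?_,
    map_fibreMeasure_compl_splitLocus_prod_univ F ι S hS h hh e b b' hfib⟩
  set G : (κ → K) × (κ → K) → (κ → K) × (κ → K) := fun z =>
    (((g : Matrix κ κ K) *ᵥ z.1, ((g⁻¹ : GL κ K) : Matrix κ κ K)ᵀ *ᵥ z.2) : (κ → K) × (κ → K)) with hG
  set GG : ((κ → K) × (κ → K)) × Y → ((κ → K) × (κ → K)) × Y := fun z => (G z.1, z.2) with hGG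
  have hGm : Measurable G :=
    ((continuous_const.matrix_mulVec continuous_fst).prodMk (continuous_const.matrix_mulVec continuous_snd)).measurable
  have hGGm : Measurable GG := (hGm.comp measurable_fst).prodMk measurable_snd
  have hpre : (G ⁻¹' A) ×ˢ B = GG ⁻¹' (A ×ˢ B) := by
    ext z; simp only [mem_prod, mem_preimage, hGG]
  have hGGν : ((fibreMeasure F ι S hS h b).map e).map GG = (fibreMeasure F ι S hS h b).map e := by
    simpa only [hGG, hG] using map_splitAct_map_fibreMeasure_eq F ι S hS h e b T hTh hTS hST hTe g
  rw [hpre, ← Measure.map_apply hGGm (hA.prod hBm), hGGν]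

/-! ## §2 Lemme 22 for the `φ`-weighted marginal: `∫ f(z) φ(y) d(e_* μ_b) = c(φ) · ∫ f dμ_{b',v}` -/

omit [T2Space Y] in
include hfib hh hTh hTS hST hTe in
/-- **`∫⁻ f(z) φ(y) d(e_* μ_b)(z, y) = c(φ) · ∫⁻ f dμ_{b',v}`** for every Borel weight `φ ≥ 0` on `Y` with `∫_{C × Y} φ d(e_* μ_b) < ∞`
on compacts `C` and every Borel `f ≥ 0` — Lemme 22 for the `φ`-weighted marginal of the fibre measure of any invariant positive
functional. [cite: Weil1965, Chap. V n° 49 Lemma 22, p. 70; n° 51, p. 73] -/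
theorem exists_lintegral_mul_weight_map_fibreMeasure_eq_mul_fibreMeasure (φ : Y → ℝ≥0∞) (hφm : Measurable φ)
    (hφ : ∀ C : Set ((κ → K) × (κ → K)), IsCompact C →
      ∫⁻ z in C ×ˢ (univ : Set Y), φ z.2 ∂((fibreMeasure F ι S hS h b).map e) < ⊤) :
    ∃ c : ℝ≥0, ∀ f : (κ → K) × (κ → K) → ℝ≥0∞, Measurable f →
      ∫⁻ z, f z.1 * φ z.2 ∂((fibreMeasure F ι S hS h b).map e) = c * ∫⁻ z, f z ∂(SplitPlace.fibreMeasure μK hκ b') := by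
  haveI : SecondCountableTopology K := secondCountable_K''
  haveI : T2Space K := t2_K''
  haveI := secondCountableTopology_adeleRing (K := F)
  haveI : BorelSpace (ι → AdeleRing (𝓞 F) F) := Pi.borelSpace
  haveI : BorelSpace (κ → K) := Pi.borelSpace
  haveI : BorelSpace ((κ → K) × (κ → K)) := Prod.borelSpace
  haveI : BorelSpace (((κ → K) × (κ → K)) × Y) := Prod.borelSpace
  set ν := (fibreMeasure F ι S hS h b).map e with hν
  have hdens : Measurable fun z : ((κ → K) × (κ → K)) × Y => φ z.2 := hφm.comp measurable_snd
  set νφ := ν.withDensity (fun z => φ z.2) with hνφ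
  have hνφs : ∀ s, MeasurableSet s → νφ s = ∫⁻ z in s, φ z.2 ∂ν := fun s hs => withDensity_apply _ hs
  have h1 : ∀ C : Set ((κ → K) × (κ → K)), IsCompact C → νφ (C ×ˢ (univ : Set Y)) < ⊤ := fun C hC => by
    rw [hνφs _ (hC.measurableSet.prod MeasurableSet.univ)]
    exact hφ C hC
  have h2 : ∀ (g : GL κ K) (A : Set ((κ → K) × (κ → K))), MeasurableSet A →
      νφ (((fun z => (((g : Matrix κ κ K) *ᵥ z.1, ((g⁻¹ : GL κ K) : Matrix κ κ K)ᵀ *ᵥ z.2) : (κ → K) × (κ → K))) ⁻¹' A) ×ˢ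
        (univ : Set Y)) = νφ (A ×ˢ (univ : Set Y)) := by
    intro g A hA
    set G : (κ → K) × (κ → K) → (κ → K) × (κ → K) := fun z =>
      (((g : Matrix κ κ K) *ᵥ z.1, ((g⁻¹ : GL κ K) : Matrix κ κ K)ᵀ *ᵥ z.2) : (κ → K) × (κ → K)) with hG
    set GG : ((κ → K) × (κ → K)) × Y → ((κ → K) × (κ → K)) × Y := fun z => (G z.1, z.2) with hGG
    have hGm : Measurable G :=
      ((continuous_const.matrix_mulVec continuous_fst).prodMk (continuous_const.matrix_mulVec continuous_snd)).measurable
    have hGGm : Measurable GG := (hGm.comp measurable_fst).prodMk measurable_snd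
    have hpre : (G ⁻¹' A) ×ˢ (univ : Set Y) = GG ⁻¹' (A ×ˢ (univ : Set Y)) := by
      ext z; simp only [mem_prod, mem_preimage, mem_univ, and_true, hGG]
    have hAU : MeasurableSet (A ×ˢ (univ : Set Y)) := hA.prod MeasurableSet.univ
    rw [hνφs _ ((hGm hA).prod MeasurableSet.univ), hνφs _ hAU, hpre, ← lintegral_indicator (hGGm hAU),
      ← lintegral_indicator hAU]
    have hind : (fun z => (GG ⁻¹' (A ×ˢ (univ : Set Y))).indicator (fun z : ((κ → K) × (κ → K)) × Y => φ z.2) z) =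
        fun z => ((A ×ˢ (univ : Set Y)).indicator (fun z : ((κ → K) × (κ → K)) × Y => φ z.2)) (GG z) := by
      funext z
      simp only [indicator, mem_preimage, hGG]
    have hGGν : ν.map GG = ν := by
      simpa only [hν, hGG, hG] using map_splitAct_map_fibreMeasure_eq F ι S hS h e b T hTh hTS hST hTe g
    rw [hind, ← lintegral_map ((hdens).indicator hAU) hGGm, hGGν]
  have h3 : νφ ({z : (κ → K) × (κ → K) | z.1 ⬝ᵥ z.2 = b' ∧ z.1 ≠ 0 ∧ z.2 ≠ 0}ᶜ ×ˢ (univ : Set Y)) = 0 :=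
    withDensity_absolutelyContinuous _ _ (map_fibreMeasure_compl_splitLocus_prod_univ F ι S hS h hh e b b' hfib)
  obtain ⟨c, hc⟩ := SplitPlace.exists_lintegral_fst_mul_indicator_snd_eq_mul_fibreMeasure μK hκ b' νφ MeasurableSet.univ
    h1 h2 h3
  refine ⟨c, fun f hf => ?_⟩
  have key := hc f hf
  simp only [indicator_univ, Pi.one_apply, mul_one] at key
  rw [← key, hνφ]
  refine Eq.trans ?_ (lintegral_withDensity_eq_lintegral_mul ν hdens
    (show Measurable fun p : ((κ → K) × (κ → K)) × Y => f p.1 from hf.comp measurable_fst)).symm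
  refine lintegral_congr fun z => ?_
  simp only [Pi.mul_apply, mul_comm]

omit [T2Space Y] in
include hfib hh hTh hTS hST hTe in
/-- weighted form on sets: `∫ 𝟙_A(z) φ(y) d(e_* μ_b) = c(φ) · μ_{b',v}(A)`. [cite: Weil1965, Chap. V n° 49 Lemma 22, p. 70; n° 51, p. 73] -/
theorem exists_lintegral_indicator_mul_weight_map_fibreMeasure_eq_mul_fibreMeasure (φ : Y → ℝ≥0∞) (hφm : Measurable φ)
    (hφ : ∀ C : Set ((κ → K) × (κ → K)), IsCompact C →
      ∫⁻ z in C ×ˢ (univ : Set Y), φ z.2 ∂((fibreMeasure F ι S hS h b).map e) < ⊤) :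
    ∃ c : ℝ≥0, ∀ A : Set ((κ → K) × (κ → K)), MeasurableSet A →
      ∫⁻ z, A.indicator 1 z.1 * φ z.2 ∂((fibreMeasure F ι S hS h b).map e) = c * SplitPlace.fibreMeasure μK hκ b' A := by
  obtain ⟨c, hc⟩ := exists_lintegral_mul_weight_map_fibreMeasure_eq_mul_fibreMeasure F ι S hS h hh μK hκ e b b' hfib T hTh hTS
    hST hTe φ hφm hφ
  refine ⟨c, fun A hA => ?_⟩
  rw [hc (A.indicator 1) (measurable_one.indicator hA), lintegral_indicator_one hA]

include hfib hh hTh hTS hST hTe in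
/-- the finiteness hypothesis DISCHARGED for a bounded weight vanishing off a relatively compact set.
[cite: Weil1965, Chap. V n° 49 Lemma 22, p. 70] -/
theorem exists_lintegral_mul_weight_map_fibreMeasure_eq_mul_fibreMeasure_of_bdd (φ : Y → ℝ≥0∞) (hφm : Measurable φ)
    {M : ℝ≥0} (hφM : ∀ y, φ y ≤ M) {B : Set Y} (hφB : ∀ y, φ y ≠ 0 → y ∈ B) (hBc : IsCompact (closure B)) :
    ∃ c : ℝ≥0, ∀ f : (κ → K) × (κ → K) → ℝ≥0∞, Measurable f →
      ∫⁻ z, f z.1 * φ z.2 ∂((fibreMeasure F ι S hS h b).map e) = c * ∫⁻ z, f z ∂(SplitPlace.fibreMeasure μK hκ b') := by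
  haveI : SecondCountableTopology K := secondCountable_K''
  haveI : T2Space K := t2_K''
  haveI : BorelSpace (κ → K) := Pi.borelSpace
  haveI : BorelSpace ((κ → K) × (κ → K)) := Prod.borelSpace
  haveI : BorelSpace (((κ → K) × (κ → K)) × Y) := Prod.borelSpace
  refine exists_lintegral_mul_weight_map_fibreMeasure_eq_mul_fibreMeasure F ι S hS h hh μK hκ e b b' hfib T hTh hTS hST hTe φ
    hφm fun C hC => ?_
  set ν := (fibreMeasure F ι S hS h b).map e with hν
  have hfinC : ν (C ×ˢ closure B) < ⊤ := map_fibreMeasure_prod_lt_top F ι S hS h e b hC hBc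
  have hle : ∀ z : ((κ → K) × (κ → K)) × Y, (C ×ˢ (univ : Set Y)).indicator (fun z => φ z.2) z ≤
      (C ×ˢ closure B).indicator (fun _ => (M : ℝ≥0∞)) z := by
    intro z
    by_cases hz : z ∈ C ×ˢ closure B
    · rw [indicator_of_mem hz]
      exact (indicator_le_self _ _ z).trans (hφM z.2)
    · rw [indicator_of_notMem hz]
      refine le_of_eq ?_
      by_cases hzC : z ∈ C ×ˢ (univ : Set Y)
      · rw [indicator_of_mem hzC]
        by_contra hne
        exact hz ⟨hzC.1, subset_closure (hφB z.2 hne)⟩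
      · exact indicator_of_notMem hzC _
  calc ∫⁻ z in C ×ˢ (univ : Set Y), φ z.2 ∂ν
      = ∫⁻ z, (C ×ˢ (univ : Set Y)).indicator (fun z => φ z.2) z ∂ν :=
        (lintegral_indicator (hC.measurableSet.prod MeasurableSet.univ) _).symm
    _ ≤ ∫⁻ z, (C ×ˢ closure B).indicator (fun _ => (M : ℝ≥0∞)) z ∂ν := lintegral_mono hle
    _ = M * ν (C ×ˢ closure B) := lintegral_indicator_const (hC.measurableSet.prod isClosed_closure.measurableSet) _
    _ < ⊤ := ENNReal.mul_lt_top ENNReal.coe_lt_top hfinC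

omit [T2Space Y] in
include hfib hh hTh hTS hST hTe in
/-- the finiteness hypothesis DISCHARGED by TEMPEREDNESS of `μ_b ≤ ν_S` (★ `integral_schwartzBruhatMeasure_le_of_nonneg`): weights
dominated on each `e⁻¹(C × Y)`, `C` compact, by a nonnegative Schwartz–Bruhat function of `X` — the case `φ ∈ 𝒮_ℝ(Y)`, `φ ≥ 0`.
[cite: Weil1965, Chap. I n° 2 Lemme 3, p. 7; Chap. V n° 49 Lemma 22, p. 70; n° 51, p. 73] -/
theorem exists_lintegral_mul_weight_map_fibreMeasure_eq_mul_fibreMeasure_of_schwartzBruhat (φ : Y → ℝ≥0∞)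
    (hφm : Measurable φ)
    (hdom : ∀ C : Set ((κ → K) × (κ → K)), IsCompact C → ∃ Ψ : piSchwartzBruhatReal F ι,
      0 ≤ (Ψ : (ι → AdeleRing (𝓞 F) F) → ℝ) ∧
        ∀ x, (e x).1 ∈ C → φ (e x).2 ≤ ENNReal.ofReal ((Ψ : (ι → AdeleRing (𝓞 F) F) → ℝ) x)) :
    ∃ c : ℝ≥0, ∀ f : (κ → K) × (κ → K) → ℝ≥0∞, Measurable f →
      ∫⁻ z, f z.1 * φ z.2 ∂((fibreMeasure F ι S hS h b).map e) = c * ∫⁻ z, f z ∂(SplitPlace.fibreMeasure μK hκ b') := by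
  haveI : SecondCountableTopology K := secondCountable_K''
  haveI : T2Space K := t2_K''
  haveI := secondCountableTopology_adeleRing (K := F)
  haveI : BorelSpace (ι → AdeleRing (𝓞 F) F) := Pi.borelSpace
  haveI : BorelSpace (κ → K) := Pi.borelSpace
  haveI : BorelSpace ((κ → K) × (κ → K)) := Prod.borelSpace
  haveI : BorelSpace (((κ → K) × (κ → K)) × Y) := Prod.borelSpace
  refine exists_lintegral_mul_weight_map_fibreMeasure_eq_mul_fibreMeasure F ι S hS h hh μK hκ e b b' hfib T hTh hTS hST hTe φ
    hφm fun C hC => ?_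
  obtain ⟨Ψ, hΨ0, hΨ⟩ := hdom C hC
  set μb := fibreMeasure F ι S hS h b with hμb
  have hem : Measurable e := e.continuous.measurable
  have hCU : MeasurableSet (C ×ˢ (univ : Set Y)) := hC.measurableSet.prod MeasurableSet.univ
  have hint : Integrable (Ψ : (ι → AdeleRing (𝓞 F) F) → ℝ) μb :=
    (integral_schwartzBruhatMeasure_le_of_nonneg F ι S hS Ψ hΨ0).1.mono_measure (fibreMeasure_le F ι S hS h b)
  have hdomx : ∀ x, (C ×ˢ (univ : Set Y)).indicator (fun z : ((κ → K) × (κ → K)) × Y => φ z.2) (e x) ≤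
      ‖(Ψ : (ι → AdeleRing (𝓞 F) F) → ℝ) x‖ₑ := by
    intro x
    by_cases hx : e x ∈ C ×ˢ (univ : Set Y)
    · rw [indicator_of_mem hx, Real.enorm_eq_ofReal (hΨ0 x)]
      exact hΨ x hx.1
    · rw [indicator_of_notMem hx]
      exact bot_le
  calc ∫⁻ z in C ×ˢ (univ : Set Y), φ z.2 ∂(μb.map e)
      = ∫⁻ z, (C ×ˢ (univ : Set Y)).indicator (fun z => φ z.2) z ∂(μb.map e) := (lintegral_indicator hCU _).symm
    _ = ∫⁻ x, (C ×ˢ (univ : Set Y)).indicator (fun z => φ z.2) (e x) ∂μb :=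
        lintegral_map ((hφm.comp measurable_snd).indicator hCU) hem
    _ ≤ ∫⁻ x, ‖(Ψ : (ι → AdeleRing (𝓞 F) F) → ℝ) x‖ₑ ∂μb := lintegral_mono hdomx
    _ < ⊤ := hint.2

omit [T2Space Y] in
include hfib hh hTh hTS hST hTe in
/-- weighted form, REAL (Bochner) version: `∫ f(z) φ(y) d(e_* μ_b) = c(φ) · ∫ f dμ_{b',v}` for Borel `f, φ ≥ 0`.
[cite: Weil1965, Chap. V n° 49 Lemma 22, p. 70; n° 51, p. 73] -/
theorem exists_integral_mul_weight_map_fibreMeasure_eq_mul_integral_fibreMeasure (φ : Y → ℝ) (hφm : Measurable φ)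
    (hφ0 : ∀ y, 0 ≤ φ y)
    (hφ : ∀ C : Set ((κ → K) × (κ → K)), IsCompact C →
      ∫⁻ z in C ×ˢ (univ : Set Y), ENNReal.ofReal (φ z.2) ∂((fibreMeasure F ι S hS h b).map e) < ⊤) :
    ∃ c : ℝ≥0, ∀ f : (κ → K) × (κ → K) → ℝ, Measurable f → (∀ z, 0 ≤ f z) →
      ∫ z, f z.1 * φ z.2 ∂((fibreMeasure F ι S hS h b).map e) = c * ∫ z, f z ∂(SplitPlace.fibreMeasure μK hκ b') := by
  haveI : SecondCountableTopology K := secondCountable_K''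
  haveI : T2Space K := t2_K''
  haveI : BorelSpace (κ → K) := Pi.borelSpace
  haveI : BorelSpace ((κ → K) × (κ → K)) := Prod.borelSpace
  haveI : BorelSpace (((κ → K) × (κ → K)) × Y) := Prod.borelSpace
  obtain ⟨c, hc⟩ := exists_lintegral_mul_weight_map_fibreMeasure_eq_mul_fibreMeasure F ι S hS h hh μK hκ e b b' hfib T hTh
    hTS hST hTe (fun y => ENNReal.ofReal (φ y)) (by fun_prop) hφ
  refine ⟨c, fun f hf hf0 => ?_⟩
  set ν := (fibreMeasure F ι S hS h b).map e with hν
  have hF : Measurable fun z : ((κ → K) × (κ → K)) × Y => f z.1 * φ z.2 :=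
    (hf.comp measurable_fst).mul (hφm.comp measurable_snd)
  have hI1 := integral_eq_lintegral_of_nonneg_ae (μ := ν) (f := fun z : ((κ → K) × (κ → K)) × Y => f z.1 * φ z.2)
    (Eventually.of_forall fun z => mul_nonneg (hf0 z.1) (hφ0 z.2)) hF.aestronglyMeasurable
  have hI2 := integral_eq_lintegral_of_nonneg_ae (μ := SplitPlace.fibreMeasure μK hκ b') (f := f)
    (Eventually.of_forall fun z => hf0 z) hf.aestronglyMeasurable
  rw [hI1, hI2]
  have hofReal : (fun z : ((κ → K) × (κ → K)) × Y => ENNReal.ofReal (f z.1 * φ z.2)) =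
      fun z => ENNReal.ofReal (f z.1) * ENNReal.ofReal (φ z.2) := by
    funext z; exact ENNReal.ofReal_mul (hf0 z.1)
  rw [hofReal, hc (fun x => ENNReal.ofReal (f x)) (by fun_prop), ENNReal.toReal_mul, ENNReal.coe_toReal]

include hfib hh hTh hTS hST hTe in
/-- **rectangles**: `(e_* μ_b)(A × B) = c_B · μ_{b',v}(A)` for Borel `A` and relatively compact Borel `B ⊆ Y` (Lemme 22 ★
`SplitPlace.exists_measure_prod_splitLocus_eq_mul_fibreMeasure` on the inputs of §1). [cite: Weil1965, Chap. V n° 49 Lemma 22, p. 70] -/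
theorem map_fibreMeasure_prod_eq_mul_fibreMeasure {B : Set Y} (hBm : MeasurableSet B) (hBc : IsCompact (closure B)) :
    ∃ c : ℝ≥0, ∀ A : Set ((κ → K) × (κ → K)), MeasurableSet A →
      ((fibreMeasure F ι S hS h b).map e) (A ×ˢ B) = c * SplitPlace.fibreMeasure μK hκ b' A := by
  obtain ⟨h1, h2, h3⟩ := map_fibreMeasure_identityClose_hypotheses F ι S hS h hh e b b' hfib T hTh hTS hST hTe
  refine SplitPlace.exists_measure_prod_splitLocus_eq_mul_fibreMeasure μK hκ b' _ (fun C hC => ?_)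
    (fun g A hA => h2 g A B hA hBm) (measure_mono_null (prod_mono subset_rfl (subset_univ B)) h3)
  exact (measure_mono (prod_mono subset_rfl subset_closure)).trans_lt
    (h1 C (closure B) hC hBc)

end Literature.NumberTheory.Weil1965

end
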